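import Summits.RiemannHypothesis.RiemannHypothesis.Theorems.Splittings.RobinFiniteThetaLiftCore
import HarnessLib

/-!
# RobinFiniteThetaLiftLaw — gen 13 θ-CEILING LIFT, part 5/6 (R2b): the top window with the S²-price and the law WITHOUT the range condition

Cell rh-split, seat rh-split-robin-finite g13 (card `cards/SPLIT-robin-finite.md` §20, «θ-CEILING LIFT WITH NO NEW INPUT»).
A use-site audit of the tree's exchange engine shows that above the `Q`-scale every `θ`-evaluation consumes only RELATIVE precision
— RH-free from the two named facts the engine already carries, Büthe 2018 Thm 2 (`x ≤ 10¹⁹`) and BKLNW 2021 §1.2 (`x ≥ 10¹⁹`) — except the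
E-side term `S²(x) = (θ(x) − x)²/(x² log x)`, which BKLNW bounds by `1.43641·10⁻⁹/log⁵x`.  Parts 1–6 re-read the engine accordingly: above
`2.5·10²²` NO Schoenfeld-form window, NO Büthe 2016, NO range condition `4.92·√(X/log X) ≤ T`; RH to height `T` enters only through the
zero side, and the budget acquires the `T`-independent S²-price `2.07·10⁻¹⁶·√X` (BKLNW ceiling `X ≲ 5.5·10³⁰`).

This part (0 `def`): `l4_cancel`, `EbS_mul_le_box_top` (the tree's box bound with the Schoenfeld `L⁴` term cancelled against `−log³P/(64π²P)` and the
S²-price `q` carried), `EbS_top_lt` (constant `2.5745` under `(1 + 2/log(2·10²²))·t + 2.07·10⁻¹⁶·√X ≤ 0.4857`), `mertensProdLt_of_offLineR` and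
`robinCA_below_of_offLineR` (gen 12's `…_of_offLine` minus `hBu`).

HONEST LABEL: SPLITTING SEARCH over kernel-typed RH-EQUIVALENCES; a splitting A ∧ B ⟹ RH is CONDITIONAL
bookkeeping unless A and B are both proved; nothing here bears on the truth of RH.
-/

set_option linter.dupNamespace false

noncomputable section

namespace Summit.RiemannHypothesis.RiemannHypothesis.Theorems.Splittings.RobinFiniteC1

section LawS

open Real Filter Finset
open scoped Chebyshev ComplexConjugate
open Literature.NumberTheory.LFunctions Literature.NumberTheory.DiophantineGeometry
open Literature.NumberTheory.LFunctions.SchoenfeldBound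
open Literature.NumberTheory.LFunctions.NicolasJExplicit
open RobinAnalyticSharp
open Summit.RiemannHypothesis.RiemannHypothesis.Theorems.Splittings.RobinFiniteE3
open Summit.RiemannHypothesis.RiemannHypothesis.Theorems.Splittings.RobinFiniteTail
open Summit.RiemannHypothesis.RiemannHypothesis.Theorems.Splittings.RobinFiniteE1c (summable_tailTerm)

/-! ### R2b · the top window `[2·10²², X]` with the S²-price: box bound, the constant `2.5745`, the law WITHOUT `hBu` -/

/-- Algebra: `L³/(c·(s·s))·(s·L) = L⁴/s/c` (`s, c > 0`) — the Schoenfeld `L⁴` term of `Eb_mul_eq` against the removed `log³/(64π²P)`. -/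
theorem l4_cancel {L s c : ℝ} (hs : 0 < s) (hc : 0 < c) : L ^ 3 / (c * (s * s)) * (s * L) = L ^ 4 / s / c := by
  rw [div_mul_eq_mul_div, div_div, div_eq_div_iff (mul_pos hc (mul_pos hs hs)).ne' (mul_pos hs hc).ne']
  ring

/-- R2 · **Box bound for the MODIFIED error `Eb b P + (s − log³P/(64π²P))` on an unbounded window `[X₀, ∞)`** (gen 13; copy of
`Eb_mul_le_box_top`): the Schoenfeld term `log⁴P/(64π²√P)` of `Eb_mul_eq` CANCELS against `−log³P/(64π²P)·√P log P`, and the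
S²-price `s` enters as `s·√P·log P`: `(Eb b P + (s − log³P/(64π²P)))·√P log P ≤ (b + 2.042) + 1.84/s₁ + 2/y₁ + s·(√P log P)`. -/
theorem EbS_mul_le_box_top {b P X₀ L₁ s₁ y₁ q : ℝ} (hb : b ≤ 0.68) (hX₀ : 1 < X₀)
    (hPl : X₀ ≤ P) (hL₁ : L₁ ≤ Real.log X₀) (hL₁8 : 8 ≤ L₁)
    (hs₁ : s₁ ≤ √X₀) (hs₁0 : 0 < s₁) (hy₁ : y₁ ≤ X₀ ^ ((1 : ℝ) / 6)) (hy₁0 : 0 < y₁) :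
    (nicolasERH P + (b - nicolasBeta) * (1 / (√P * Real.log P) + 1 / (√P * Real.log P ^ 2) + 4 / (√P * Real.log P ^ 3)) +
        (q - Real.log P ^ 3 / (64 * π ^ 2 * P))) * (√P * Real.log P) ≤
      (b + 2.042) + 1.84 / s₁ + 2 / y₁ + q * (√P * Real.log P) := by
  have hX₀0 : 0 < X₀ := by linarith
  have hP0 : 0 < P := by linarith
  have hP1 : 1 < P := by linarith
  have ecancel : Real.log P ^ 3 / (64 * π ^ 2 * P) * (√P * Real.log P) = Real.log P ^ 4 / √P / (64 * π ^ 2) := by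
    have h := l4_cancel (L := Real.log P) (c := 64 * π ^ 2) (Real.sqrt_pos.2 hP0) (by positivity)
    rwa [Real.mul_self_sqrt hP0.le] at h
  rw [add_mul, Eb_mul_eq hP1, sub_mul, ecancel]
  set L := Real.log P with hL
  set s := √P with hs
  set y := P ^ ((1 : ℝ) / 6) with hy
  have hs0 : 0 < s := Real.sqrt_pos.2 hP0
  have hLX₀ : Real.log X₀ ≤ L := Real.log_le_log hX₀0 hPl
  have hLl : L₁ ≤ L := hL₁.trans hLX₀
  have hL8 : 8 ≤ L := hL₁8.trans hLl
  have hL0 : 0 < L := by linarith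
  have hsl : s₁ ≤ s := hs₁.trans (Real.sqrt_le_sqrt hPl)
  have hyl : y₁ ≤ y := hy₁.trans (Real.rpow_le_rpow hX₀0.le hPl (by norm_num))
  -- the two `L` terms are jointly `≤ 0`
  have hnum : 8.168 + 4 * b ≤ (2.042 - b) * L := by
    nlinarith [mul_nonneg (sub_nonneg.2 (show b ≤ 2.042 by linarith)) (sub_nonneg.2 hL8)]
  have b23 : -((2.042 - b) / L) + (8.168 + 4 * b) / L ^ 2 ≤ 0 := by
    have h1 : (8.168 + 4 * b) / L ^ 2 ≤ (2.042 - b) / L := by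
      rw [div_le_div_iff₀ (by positivity) hL0]
      calc (8.168 + 4 * b) * L ≤ ((2.042 - b) * L) * L := mul_le_mul_of_nonneg_right hnum hL0.le
        _ = (2.042 - b) * L ^ 2 := by ring
    linarith
  have b4 : Real.log (2 * π) / s ≤ 1.84 / s₁ := by
    have h0 : 0 ≤ Real.log (2 * π) := Real.log_nonneg (by linarith [Real.pi_gt_three])
    calc Real.log (2 * π) / s ≤ Real.log (2 * π) / s₁ := div_le_div_of_nonneg_left h0 hs₁0 hsl
      _ ≤ 1.84 / s₁ := div_le_div_of_nonneg_right log_two_pi_le hs₁0.le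
  have b5 : 2 / y ≤ 2 / y₁ := div_le_div_of_nonneg_left (by norm_num) hy₁0 hyl
  linarith

/-- **R2b · the top window `[2·10²², X]` with the S²-price, against the lifted constant `c(51.35) = 2.5745`**: if
`(1 + 2/log(2·10²²))·t + 2.07·10⁻¹⁶·√X ≤ 0.4857` then for every `2·10²² ≤ P ≤ X`
`(Eb(0.0463 + (1 + 2/log(2·10²²))·t) P + (1.43641·10⁻⁹/log⁵P − log³P/(64π²P)))·√P log P < 2.5745` — box
`b + 2.042 + 1.31·10⁻¹¹ + 3.8388·10⁻⁴ + 1.43641·10⁻⁹·√P/log⁴P`, `√P/log⁴P ≤ √X/51.35⁴`, `1.43641·10⁻⁹/51.35⁴ ≤ 2.07·10⁻¹⁶`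
(enclosures `51.35 ≤ log(2·10²²)`, `141421356237 ≤ √(2·10²²)`, `5210 ≤ (2·10²²)^{1/6}` from the tree). -/
theorem EbS_top_lt {P X t : ℝ} (h0 : 2 * (10 : ℝ) ^ 22 ≤ P) (hPX : P ≤ X)
    (hκ : (1 + 2 / Real.log (2 * (10 : ℝ) ^ 22)) * t + 2.07e-16 * √X ≤ 0.4857) :
    (nicolasERH P + ((0.0463 + (1 + 2 / Real.log (2 * (10 : ℝ) ^ 22)) * t) - nicolasBeta) * (1 / (√P * Real.log P) + 1 / (√P * Real.log P ^ 2) + 4 / (√P * Real.log P ^ 3)) +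
        (1.43641e-9 / Real.log P ^ 5 - Real.log P ^ 3 / (64 * π ^ 2 * P))) * (√P * Real.log P) < 2.5745 := by
  obtain ⟨hL, hU⟩ := log_2e22_bounds
  obtain ⟨hs, -⟩ := sqrt_between (s := 141421356237) (u := 141421356238) (X := 2 * (10 : ℝ) ^ 22)
    (by norm_num) (by norm_num) (by norm_num)
  have hy := le_rpow_sixth (X := 2 * (10 : ℝ) ^ 22) (y := 5210) (by norm_num) (by norm_num)
  have hP0 : 0 < P := lt_of_lt_of_le (by norm_num) h0
  have hLP : (51.35 : ℝ) ≤ Real.log P := hL.trans (Real.log_le_log (by norm_num) h0)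
  have hLP0 : 0 < Real.log P := by linarith
  have hsX : √P ≤ √X := Real.sqrt_le_sqrt hPX
  have hsX0 : 0 ≤ √X := Real.sqrt_nonneg X
  have hsP0 : 0 ≤ √P := Real.sqrt_nonneg P
  -- the S²-price: `1.43641e-9/L⁵ · (√P L) = 1.43641e-9 · √P/L⁴ ≤ 2.07e-16 · √X`
  have hS : 1.43641e-9 / Real.log P ^ 5 * (√P * Real.log P) ≤ 2.07e-16 * √X := by
    have e : 1.43641e-9 / Real.log P ^ 5 * (√P * Real.log P) = 1.43641e-9 * √P / Real.log P ^ 4 := by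
      field_simp
    rw [e, div_le_iff₀ (by positivity)]
    have hL4 : (51.35 : ℝ) ^ 4 ≤ Real.log P ^ 4 := pow_le_pow_left₀ (by norm_num) hLP 4
    calc 1.43641e-9 * √P ≤ 1.43641e-9 * √X := by gcongr
      _ ≤ 2.07e-16 * √X * (51.35 : ℝ) ^ 4 := by nlinarith [hsX0]
      _ ≤ 2.07e-16 * √X * Real.log P ^ 4 := by gcongr
  have hb68 : 0.0463 + (1 + 2 / Real.log (2 * (10 : ℝ) ^ 22)) * t ≤ 0.68 := by
    -- `linarith` must not see the numeral `2·10²²` inside `log` (cancel_denoms normalises it in some hypotheses only)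
    set L0 : ℝ := Real.log (2 * (10 : ℝ) ^ 22) with hL0_def
    nlinarith [hsX0]
  have hbox := EbS_mul_le_box_top (P := P) (q := 1.43641e-9 / Real.log P ^ 5)
    (b := 0.0463 + (1 + 2 / Real.log (2 * (10 : ℝ) ^ 22)) * t) hb68 (by norm_num) h0 hL
    (by norm_num) hs (by norm_num) hy (by norm_num)
  have hnum : (1.84 : ℝ) / 141421356237 + 2 / 5210 < 2.5745 - 2.042 - 0.0463 - 0.4857 := by norm_num
  clear hs hy
  set L0 : ℝ := Real.log (2 * (10 : ℝ) ^ 22) with hL0_def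
  nlinarith [hsX0]

/-- **R2b · THE TOP-WINDOW CONSUMER WITH A GENERAL OFF-LINE BOUND AND NO RANGE CONDITION** (gen 12's `mertensProdLt_of_offLine`
minus `hBu`, plus the S²-price): RH to height `T ≥ 3 000 175 332 800`, the three `θ`-facts (Büthe 2016 is used ONLY below `2.5·10²²`,
through gen 8's `mertensProdLt_PT2`), a uniform bound `D ≥ 0` for the weighted off-line sum on `[2·10²², X]` with
`(1 + 2/log(2·10²²))·D + 2.07·10⁻¹⁶·√X ≤ 0.4857` give the CA Mertens inequality for `4¹¹ ≤ P ≤ X`, `Q ≤ P`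
(above `2.5·10²²`: `partialNicolasBetweenS_holds`, `EbS_top_lt`, `G_large2R` with `c = 2.5745`, `mertens_prod_lt_ofR`). -/
theorem mertensProdLt_of_offLineR (h16 : Buthe2016_thm2) (hB : Buthe2018_thm2_theta)
    (hK : BroadbentEtAl2021_theta_rel_1e19) {T : ℝ} (hT : 3000175332800 ≤ T) (hRH : RiemannHypothesisUpTo T)
    {X D : ℝ}
    (hoff : ∀ x : ℝ, 2 * (10 : ℝ) ^ 22 ≤ x → x ≤ X →
      ∑' ρ : RHWave0.riemannZetaNontrivialZeros,
        (if T < |(ρ : ℂ).im| then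
          (riemannZetaZeroOrder (ρ : ℂ) : ℝ) * x ^ ((ρ : ℂ).re - 1 / 2) / (ρ : ℂ).im ^ 2 else 0) ≤ D)
    (hD : 0 ≤ D) (hκ : (1 + 2 / Real.log (2 * (10 : ℝ) ^ 22)) * D + 2.07e-16 * √X ≤ 0.4857)
    {P Q : ℕ} (hP : 4 ^ 11 ≤ P) (hPX : (P : ℝ) ≤ X) (hQP : Q ≤ P) :
    (∏ p ∈ Nat.primesLE P, (1 - (p : ℝ)⁻¹))⁻¹ *
        ∏ p ∈ (Nat.primesLE P).filter (fun p => Q < p), (1 - ((p : ℝ) ^ 2)⁻¹) <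
      rexp eulerMascheroniConstant * Real.log (θ P + θ Q) := by
  rcases le_or_gt (P : ℝ) (25 * (10 : ℝ) ^ 21) with hlo | hhi
  · exact mertensProdLt_PT2 h16 hB hK (RiemannHypothesisUpTo.mono_of_le hT hRH) hP hlo hQP
  · have h22 : 2 * (10 : ℝ) ^ 22 ≤ P := le_trans (by norm_num) hhi.le
    have hPr : (4 : ℝ) ^ 11 ≤ P := by exact_mod_cast hP
    have hP599 : (599 : ℝ) ≤ P := le_trans (by norm_num) hPr
    have hP1 : (1 : ℝ) < P := by linarith
    have hbig19 : (2 * 10 ^ 19 : ℝ) ≤ P := le_trans (by norm_num) h22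
    have hlow := partialNicolasBetweenS_holds hB hK (T := T) (X₀ := 2 * (10 : ℝ) ^ 22) (X₁ := X)
      hoff hD (by norm_num) hRH P h22 hPX
    have hsL : 0 < √(P : ℝ) * Real.log P := mul_pos (Real.sqrt_pos.2 (by linarith)) (Real.log_pos hP1)
    have hlt := EbS_top_lt h22 hPX hκ
    have hL₁P : (51.35 : ℝ) ≤ Real.log P := log_2e22_bounds.1.trans (Real.log_le_log (by norm_num) h22)
    have hG := G_large2R hB hK hbig19 hQP hL₁P (by norm_num) (c := 2.5745) (by norm_num) (by norm_num)
    exact mertens_prod_lt_ofR hP hlow (((lt_div_iff₀ hsL).2 hlt).trans_le hG)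

open scoped ArithmeticFunction.sigma in
/-- **R2b · Robin at CA numbers from a general off-line bound, NO RANGE CONDITION** (gen 12's `robinCA_below_of_offLine` minus
`hBu`): RH to height `T ≥ 3 000 175 332 800`, the three `θ`-facts, an off-line bound `D` on `[2·10²², X]` with
`(1 + 2/log(2·10²²))·D + 2.07·10⁻¹⁶·√X ≤ 0.4857` give Robin's inequality at every colossally abundant `N > 5040` all of whose
primes are `≤ X`.  Nothing here bears on the truth of RH. -/
theorem robinCA_below_of_offLineR (h16 : Buthe2016_thm2) (hB : Buthe2018_thm2_theta)
    (hK : BroadbentEtAl2021_theta_rel_1e19) {T : ℝ} (hT : 3000175332800 ≤ T) (hRH : RiemannHypothesisUpTo T)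
    {X : ℕ} {D : ℝ}
    (hoff : ∀ x : ℝ, 2 * (10 : ℝ) ^ 22 ≤ x → x ≤ (X : ℝ) →
      ∑' ρ : RHWave0.riemannZetaNontrivialZeros,
        (if T < |(ρ : ℂ).im| then
          (riemannZetaZeroOrder (ρ : ℂ) : ℝ) * x ^ ((ρ : ℂ).re - 1 / 2) / (ρ : ℂ).im ^ 2 else 0) ≤ D)
    (hD : 0 ≤ D) (hκ : (1 + 2 / Real.log (2 * (10 : ℝ) ^ 22)) * D + 2.07e-16 * √(X : ℝ) ≤ 0.4857) :
    robinCA_below (X + 1) := by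
  intro N hCA h5040 hprimes
  obtain ⟨ε, P, Q, -, -, hP, hPN, -, hQP, hpf, -, -, hσ, hθ, -⟩ := hCA.exists_structure
  by_cases hsmall : P < 4 ^ 11
  · refine robinCA_below_four_pow_eleven N hCA h5040 fun p hp hpN => lt_of_le_of_lt ?_ hsmall
    have hN0 : N ≠ 0 := by omega
    have : p ∈ N.primeFactors := Nat.mem_primeFactors.2 ⟨hp, hpN, hN0⟩
    rw [hpf] at this
    exact (Nat.mem_primesLE.1 this).1
  · rw [not_lt] at hsmall
    have hPX : (P : ℝ) ≤ X := by
      have := hprimes P hP hPN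
      exact_mod_cast Nat.lt_succ_iff.1 this
    have hlt := mertensProdLt_of_offLineR h16 hB hK hT hRH hoff hD hκ hsmall hPX hQP
    have hN0 : N ≠ 0 := by omega
    have hNpos : (0 : ℝ) < N := by exact_mod_cast Nat.pos_of_ne_zero hN0
    have hθpos : 0 < θ P + θ Q := by
      have h1 : 0 < θ (P : ℝ) := Chebyshev.theta_pos (by exact_mod_cast hP.two_le)
      have h2 : 0 ≤ θ (Q : ℝ) := Chebyshev.theta_nonneg _
      linarith
    have hlog : Real.log (θ P + θ Q) ≤ Real.log (Real.log N) := Real.log_le_log hθpos hθ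
    have hlt' : (σ 1 N : ℝ) / N < rexp eulerMascheroniConstant * Real.log (Real.log N) :=
      lt_of_le_of_lt hσ (hlt.trans_le (mul_le_mul_of_nonneg_left hlog (Real.exp_pos _).le))
    unfold robinInequality
    rw [div_lt_iff₀ hNpos] at hlt'
    linarith

end LawS

end Summit.RiemannHypothesis.RiemannHypothesis.Theorems.Splittings.RobinFiniteC1

end
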